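import Literature.MathematicalPhysics.QuantumFieldTheory.Federbush1986.ModeAnalyticity
import Literature.Analysis.Complex.LocallyUniformLimitSCV

/-!
# Federbush–Williamson, *A phase cell approach to Yang–Mills theory. II. Analysis of a mode* (J. Math. Phys. **28**
# (1987) 1416–1419) [FederbushWilliamson1987PhaseCellII] — the `n ≠ 0` lattice sums `D_j` behind (5.3), (6.5)–(6.7):
# normal convergence, analyticity near `p = 0`, and the uniform bound `‖D_j(p)‖ ≤ 1/12` on `‖p‖ < 1/2`

statement-level skeleton of published theorems with citation tags; proofs where landed; nothing here is a claim about
the Yang–Mills mass gap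

PDF held: Deep-Blue scan `run/shared/lean/pub/pub-balaban/t4/b2b-balaban-t4-lit2/pdf/fedwill1987-jmp28-II.pdf`, page
renders `…/b2b-balaban-t4-lit2/g7/fw1987II/fedwill1987-jmp28-II-p001…p004-x2.png` (all four pages read as images this
session; journal page = 1415 + PDF page).

WHAT IS REPRODUCED (cell `lit-balaban`, Phase-2 proof seat p04 gen 5, SKELETON row **F2.Thm3.1** of
`run/shared/lean/pub/lit-balaban/SKELETON.md`; HOME `run/shared/lean/pub/lit-balaban/lit-balaban-p04/`; GAPS.md §G-F2-01).
This is the first support file of the KERNEL REFUTATION of Theorem 3.1 p. 1417 as typed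
(`ModeAnalyticity.Theorem31`, sibling file of r17): the printed proof (§V–§VI, p. 1418) rests on the expansion
(5.3) `p_j²⟨1/p_j²⟩ ≡ r₀(p) e_j(p) (1/p²)`, `e_j = 1 + δ_j`, with `δ_j` written in (6.5)–(6.7) as `p²` times sums
`K_ρ`, `K¹_ρ` over the lattice vectors `n ≠ 0` with zero-set `ρ = {i : n_i = 0}`.  Splitting the `n = 0` term off the
typed bracket (1.4) gives EXACTLY `δ_j = p²·D_j` with
`D_j(p) = Σ_{n ∈ ℤ⁴∖0} [∏_{i : n_i ≠ 0} p_i²/(p_i+2πn_i)²]·θ_j(n,p) / Σ_l (p_l+2πn_l)²`, `θ_j = p_j²/(p_j+2πn_j)²` if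
`n_j ≠ 0` and `1` otherwise — the regrouping of (6.5)–(6.7) by `ρ` is this sum read off by the zero pattern of `n`
(`ratio`, `termD`, `D` below).  Proved here (kernel, no `sorry`): for `‖p‖ < 1/2` (sup norm on `ℂ⁴`) every term is
holomorphic and bounded by the summable product weight `u(n) = ∏_i b(n_i)`, `b(0) = 1`, `b(m) = 1/(25m²)`
(`norm_termD_le`, `summable_u`, with `Σ_{m∈ℤ} b(m) = 1 + π²/75 ≤ 29/25` from `hasSum_zeta_two`), hence `D_j` is
ANALYTIC on the ball (`analyticOnNhd_D`, by the Weierstrass M-test of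
`Literature.Analysis.Complex.SCV.analyticOnNhd_tsum_of_summable_norm`) — the honest content of the printed (6.1)/(6.8)
*"|K_ρ(p)| < m … for some fixed m"* — and `‖D_j(p)‖ ≤ 1/12` there (`norm_D_le`), which makes `e_j = 1 + p²D_j` and the
regrouped denominator `1 + ĝ` of (6.11)/(6.14) invertible near `0` in the sequel.  The refutation itself (the pole of
`A^N_1` along the complex light cone `p² = 0`, where the printed (6.2)/(6.12) fail) is in the sibling files
`ModeAnalyticityConeLimit`, `ModeAnalyticityBracketSplit`, `ModeAnalyticityThm31Refutation`.
D-0026: no named fact; the `def`s are the printed objects; every `Prop` is a proved `theorem`.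
-/

noncomputable section

namespace Literature.MathematicalPhysics.QuantumFieldTheory.Federbush1986

namespace ModeAnalyticityLatticeSums

open ModeAnalyticity Complex Filter Topology Finset Metric
open scoped BigOperators Real

/-- Lattice vectors `n ∈ ℤ⁴` of the sums (1.4)/(6.6)–(6.7). [cite: FederbushWilliamson1987PhaseCellII, (1.4) p. 1416] -/
abbrev Idx := Fin 4 → ℤ

/-- The non-zero lattice vectors («ρ is a proper subset», (6.5)(a) p. 1418: `n ≠ 0`).
[cite: FederbushWilliamson1987PhaseCellII, (6.5)–(6.7) p. 1418] -/
abbrev NZ := {n : Idx // n ≠ 0}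

/-- The factor `p_i²/(p_i + 2πn_i)²` of (6.6)–(6.7) for `n_i ≠ 0`, and `1` for `n_i = 0` (the cancelled form of
`p_i² · (p_i + 2πn_i)⁻²`, analytic through `p_i = 0`). [cite: FederbushWilliamson1987PhaseCellII, (6.6)–(6.7) p. 1418] -/
def ratio (n : Idx) (p : Momentum) (i : Fin 4) : ℂ :=
  if n i = 0 then 1 else (p i) ^ 2 / (shift p n i) ^ 2

/-- One term of `D_j`: `[∏_i ratio_i]·ratio_j / Σ_l (p_l + 2πn_l)²` (= the `n`-th term of `K_ρ`, resp. `p_j²K¹_ρ`-type,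
of (6.6)–(6.7) with its polynomial prefactor from (6.5)). [cite: FederbushWilliamson1987PhaseCellII, (6.5)–(6.7) p. 1418] -/
def termD (j : Fin 4) (n : Idx) (p : Momentum) : ℂ :=
  (∏ i, ratio n p i) * ratio n p j / csq (shift p n)

/-- `D_j(p) = Σ_{n ≠ 0} termD_j(n, p)`, so that `e_j = 1 + p²·D_j` in (5.3)/(6.5).
[cite: FederbushWilliamson1987PhaseCellII, (5.3), (6.5) p. 1418] -/
def D (j : Fin 4) (p : Momentum) : ℂ := ∑' n : NZ, termD j n.1 p

/-- The summable one-dimensional weight: `b(0) = 1`, `b(m) = 1/(25 m²)`. [folklore] -/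
def b (m : ℤ) : ℝ := if m = 0 then 1 else 1 / (25 * (m : ℝ) ^ 2)

/-- The product weight `u(n) = ∏_i b(n_i)` dominating the terms. [folklore] -/
def u (n : Idx) : ℝ := ∏ i, b (n i)

/-! ## Elementary facts on the weights -/

/-- (plumbing for the cited display) [cite: FederbushWilliamson1987PhaseCellII, (6.8) p. 1418] -/
theorem b_nonneg (m : ℤ) : 0 ≤ b m := by
  unfold b; split_ifs <;> positivity

/-- (plumbing for the cited display) [cite: FederbushWilliamson1987PhaseCellII, (6.8) p. 1418] -/
theorem b_le_one (m : ℤ) : b m ≤ 1 := by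
  unfold b; split_ifs with h
  · exact le_rfl
  · have h1 : (1 : ℝ) ≤ (m : ℝ) ^ 2 := by
      have : (1 : ℝ) ≤ |(m : ℝ)| := by rw [← Int.cast_abs]; exact_mod_cast Int.one_le_abs h
      nlinarith [abs_nonneg (m : ℝ), sq_abs (m : ℝ)]
    rw [div_le_one (by positivity)]; nlinarith

/-- (plumbing for the cited display) [cite: FederbushWilliamson1987PhaseCellII, (6.8) p. 1418] -/
theorem b_zero : b 0 = 1 := by simp [b]

/-- (plumbing for the cited display) [cite: FederbushWilliamson1987PhaseCellII, (6.8) p. 1418] -/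
theorem b_of_ne {m : ℤ} (h : m ≠ 0) : b m = 1 / (25 * (m : ℝ) ^ 2) := by simp [b, h]

/-- `b(m) = (1/25)·m⁻² + [m = 0]` for every `m` (Lean's `0⁻¹ = 0` makes the first term vanish at `m = 0`). [folklore] -/
private theorem b_eq (m : ℤ) : b m = (1 / 25) * (1 / (m : ℝ) ^ 2) + (if m = 0 then 1 else 0) := by
  unfold b; split_ifs with h
  · simp [h]
  · ring

/-- (plumbing for the cited display) [cite: FederbushWilliamson1987PhaseCellII, (6.8) p. 1418] -/
theorem u_nonneg (n : Idx) : 0 ≤ u n := Finset.prod_nonneg fun i _ => b_nonneg (n i)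

/-- (plumbing for the cited display) [cite: FederbushWilliamson1987PhaseCellII, (6.8) p. 1418] -/
theorem u_le_one (n : Idx) : u n ≤ 1 := Finset.prod_le_one (fun i _ => b_nonneg (n i)) fun i _ => b_le_one (n i)

/-- `Σ_{m∈ℤ} m⁻² = π²/3` (with the `m = 0` term equal to `0`). [folklore] -/
private theorem hasSum_inv_sq_int : HasSum (fun m : ℤ => 1 / (m : ℝ) ^ 2) (π ^ 2 / 3) := by
  set f : ℤ → ℝ := fun m => 1 / (m : ℝ) ^ 2 with hf
  have h1 : HasSum (fun n : ℕ => f n) (π ^ 2 / 6) := by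
    simpa only [hf, Int.cast_natCast] using hasSum_zeta_two
  have h2 : HasSum (fun n : ℕ => f (-(n + 1))) (π ^ 2 / 6) := by
    have h := (hasSum_nat_add_iff' 1).mpr hasSum_zeta_two
    have e : ∀ n : ℕ, f (-(n + 1)) = 1 / ((n + 1 : ℕ) : ℝ) ^ 2 := by
      intro n; simp only [hf]; push_cast; ring
    simp_rw [e]; simpa using h
  convert h1.of_nat_of_neg_add_one h2 using 1; ring

/-- `Σ_{m∈ℤ} b(m) = 1 + π²/75`. [cite: FederbushWilliamson1987PhaseCellII, (6.8) p. 1418] -/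
theorem hasSum_b : HasSum b (1 + π ^ 2 / 75) := by
  have h1 : HasSum (fun m : ℤ => (1 / 25 : ℝ) * (1 / (m : ℝ) ^ 2)) ((1 / 25) * (π ^ 2 / 3)) :=
    hasSum_inv_sq_int.mul_left _
  have h2 : HasSum (fun m : ℤ => if m = 0 then (1 : ℝ) else 0) 1 := hasSum_ite_eq 0 1
  convert h1.add h2 using 1
  · funext m; exact b_eq m
  · ring

/-- (plumbing for the cited display) [cite: FederbushWilliamson1987PhaseCellII, (6.8) p. 1418] -/
theorem summable_b : Summable b := hasSum_b.summable

/-- (plumbing for the cited display) [cite: FederbushWilliamson1987PhaseCellII, (6.8) p. 1418] -/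
theorem tsum_b_le : ∑' m, b m ≤ 29 / 25 := by
  rw [hasSum_b.tsum_eq]
  have : π ^ 2 ≤ 10 := by nlinarith [Real.pi_lt_d2, Real.pi_pos]
  linarith

/-- Finite partial sums of the product weight are bounded by `(Σ_ℤ b)⁴ ≤ (29/25)⁴`. [folklore] -/
private theorem sum_u_le (S : Finset Idx) : ∑ n ∈ S, u n ≤ (29 / 25 : ℝ) ^ 4 := by
  classical
  set T : Finset ℤ := Finset.univ.biUnion fun i : Fin 4 => S.image fun n : Idx => n i with hT
  have hsub : S ⊆ Fintype.piFinset fun _ : Fin 4 => T := by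
    intro n hn
    rw [Fintype.mem_piFinset]
    intro i
    rw [hT, Finset.mem_biUnion]
    exact ⟨i, Finset.mem_univ _, Finset.mem_image.mpr ⟨n, hn, rfl⟩⟩
  calc ∑ n ∈ S, u n ≤ ∑ n ∈ Fintype.piFinset (fun _ : Fin 4 => T), u n :=
        Finset.sum_le_sum_of_subset_of_nonneg hsub fun n _ _ => u_nonneg n
    _ = ∏ i : Fin 4, ∑ m ∈ T, b m := by
        rw [Finset.prod_univ_sum]; rfl
    _ ≤ ∏ _i : Fin 4, (29 / 25 : ℝ) := by
        apply Finset.prod_le_prod (fun i _ => Finset.sum_nonneg fun m _ => b_nonneg m)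
        intro i _
        exact (summable_b.sum_le_tsum T fun m _ => b_nonneg m).trans tsum_b_le
    _ = (29 / 25 : ℝ) ^ 4 := by norm_num

/-- (plumbing for the cited display) [cite: FederbushWilliamson1987PhaseCellII, (6.8) p. 1418] -/
theorem summable_u : Summable u := summable_of_sum_le u_nonneg sum_u_le

/-- (plumbing for the cited display) [cite: FederbushWilliamson1987PhaseCellII, (6.8) p. 1418] -/
theorem summable_u_NZ : Summable fun n : NZ => u n.1 := summable_u.subtype _

/-- (plumbing for the cited display) [cite: FederbushWilliamson1987PhaseCellII, (6.8) p. 1418] -/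
theorem tsum_u_NZ_le : ∑' n : NZ, u n.1 ≤ (29 / 25 : ℝ) ^ 4 := by
  refine summable_u_NZ.tsum_le_of_sum_le fun S => ?_
  calc ∑ n ∈ S, u n.1 = ∑ n ∈ S.map (Function.Embedding.subtype _), u n := by
        rw [Finset.sum_map]; rfl
    _ ≤ (29 / 25 : ℝ) ^ 4 := sum_u_le _

/-! ## The ball `‖p‖ < 1/2` and the lattice denominators -/

/-- The neighbourhood of `p = 0` used throughout: the open sup-norm ball of radius `1/2` in `ℂ⁴`.
[cite: FederbushWilliamson1987PhaseCellII, §V p. 1418 («near p = 0»)] -/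
def U : Set Momentum := ball 0 (1 / 2)

/-- (plumbing for the cited display) [cite: FederbushWilliamson1987PhaseCellII, §V p. 1418] -/
theorem isOpen_U : IsOpen U := isOpen_ball

/-- (plumbing for the cited display) [cite: FederbushWilliamson1987PhaseCellII, §V p. 1418] -/
theorem norm_apply_lt_of_mem_U {p : Momentum} (hp : p ∈ U) (i : Fin 4) : ‖p i‖ < 1 / 2 := by
  have h : ‖p‖ < 1 / 2 := by simpa [U] using hp
  exact (norm_le_pi_norm p i).trans_lt h

/-- (plumbing for the cited display) [cite: FederbushWilliamson1987PhaseCellII, (6.6)–(6.7) p. 1418] -/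
theorem shift_apply (p : Momentum) (n : Idx) (i : Fin 4) : shift p n i = p i + 2 * π * (n i : ℂ) := rfl

/-- (plumbing for the cited display) [cite: FederbushWilliamson1987PhaseCellII, (6.6)–(6.7) p. 1418] -/
theorem shift_im (p : Momentum) (n : Idx) (i : Fin 4) : (shift p n i).im = (p i).im := by
  simp [shift_apply, Complex.add_im, Complex.mul_im]

/-- (plumbing for the cited display) [cite: FederbushWilliamson1987PhaseCellII, (6.6)–(6.7) p. 1418] -/
theorem shift_re (p : Momentum) (n : Idx) (i : Fin 4) : (shift p n i).re = (p i).re + 2 * π * (n i : ℝ) := by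
  simp [shift_apply, Complex.add_re, Complex.mul_re]

/-- `1 ≤ |m|` for a non-zero integer, cast to `ℝ`. [folklore] -/
private theorem one_le_abs_cast {m : ℤ} (h : m ≠ 0) : (1 : ℝ) ≤ |(m : ℝ)| := by
  rw [← Int.cast_abs]; exact_mod_cast Int.one_le_abs h

/-- For `n_i ≠ 0` and `‖p_i‖ < 1/2`: `|Re(p_i + 2πn_i)| ≥ 5|n_i|`. [cite: FederbushWilliamson1987PhaseCellII, (6.8) p. 1418] -/
theorem abs_shift_re_ge {p : Momentum} (hp : p ∈ U) {n : Idx} {i : Fin 4} (hni : n i ≠ 0) :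
    5 * |(n i : ℝ)| ≤ |(shift p n i).re| := by
  have h1 := one_le_abs_cast hni
  have hre : |(p i).re| ≤ 1 / 2 := (Complex.abs_re_le_norm _).trans (norm_apply_lt_of_mem_U hp i).le
  rw [shift_re]
  have h2 : |2 * π * (n i : ℝ)| = 2 * π * |(n i : ℝ)| := by
    rw [abs_mul, abs_of_pos (by positivity : (0:ℝ) < 2 * π)]
  have h3 : |2 * π * (n i : ℝ)| - |(p i).re| ≤ |(p i).re + 2 * π * (n i : ℝ)| := by
    have := abs_sub_abs_le_abs_sub (2 * π * (n i : ℝ)) (-(p i).re)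
    simpa [sub_neg_eq_add, add_comm, abs_neg] using this
  nlinarith [Real.pi_gt_three]

/-- For `n_i ≠ 0` and `‖p_i‖ < 1/2`: `‖p_i + 2πn_i‖ ≥ 5|n_i|`. [cite: FederbushWilliamson1987PhaseCellII, (6.8) p. 1418] -/
theorem norm_shift_ge {p : Momentum} (hp : p ∈ U) {n : Idx} {i : Fin 4} (hni : n i ≠ 0) :
    5 * |(n i : ℝ)| ≤ ‖shift p n i‖ :=
  (abs_shift_re_ge hp hni).trans (Complex.abs_re_le_norm _)

/-- (plumbing for the cited display) [cite: FederbushWilliamson1987PhaseCellII, (6.6)–(6.7) p. 1418] -/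
theorem shift_ne_zero {p : Momentum} (hp : p ∈ U) {n : Idx} {i : Fin 4} (hni : n i ≠ 0) :
    shift p n i ≠ 0 := by
  intro h
  have := norm_shift_ge hp hni
  rw [h, norm_zero] at this
  have := one_le_abs_cast hni
  linarith

/-- `Re(z²) = (Re z)² − (Im z)²`. [folklore] -/
private theorem sq_re (z : ℂ) : (z ^ 2).re = z.re ^ 2 - z.im ^ 2 := by
  rw [pow_two, Complex.mul_re]; ring

/-- For `n ≠ 0` and `‖p‖ < 1/2`: `Re Σ_l (p_l + 2πn_l)² ≥ 24`. [cite: FederbushWilliamson1987PhaseCellII, (6.8) p. 1418] -/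
theorem re_csq_shift_ge {p : Momentum} (hp : p ∈ U) {n : Idx} (hn : n ≠ 0) :
    24 ≤ (csq (shift p n)).re := by
  obtain ⟨m, hm⟩ := Function.ne_iff.mp hn
  have hre : ∀ l, ((shift p n l) ^ 2).re = (shift p n l).re ^ 2 - (p l).im ^ 2 := fun l => by
    rw [sq_re, shift_im]
  have him : ∀ l, (p l).im ^ 2 ≤ 1 / 4 := fun l => by
    have h1 : |(p l).im| ≤ 1 / 2 := (Complex.abs_im_le_norm _).trans (norm_apply_lt_of_mem_U hp l).le
    have h2 : 0 ≤ |(p l).im| := abs_nonneg _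
    nlinarith [sq_abs ((p l).im)]
  have hm' : 25 ≤ (shift p n m).re ^ 2 := by
    have h1 := abs_shift_re_ge hp hm
    have h2 := one_le_abs_cast hm
    nlinarith [sq_abs ((shift p n m).re), abs_nonneg ((n m : ℝ))]
  unfold csq
  rw [Complex.re_sum]
  simp_rw [hre]
  rw [Finset.sum_sub_distrib]
  have hA : (shift p n m).re ^ 2 ≤ ∑ l, (shift p n l).re ^ 2 :=
    Finset.single_le_sum (f := fun l => (shift p n l).re ^ 2) (fun l _ => sq_nonneg _) (Finset.mem_univ m)
  have hB : ∑ l : Fin 4, (p l).im ^ 2 ≤ ∑ _l : Fin 4, (1 / 4 : ℝ) := Finset.sum_le_sum fun l _ => him l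
  simp only [Finset.sum_const, Finset.card_univ, Fintype.card_fin, nsmul_eq_mul] at hB
  norm_num at hB
  linarith

/-- (plumbing for the cited display) [cite: FederbushWilliamson1987PhaseCellII, (6.6)–(6.7) p. 1418] -/
theorem norm_csq_shift_ge {p : Momentum} (hp : p ∈ U) {n : Idx} (hn : n ≠ 0) : 24 ≤ ‖csq (shift p n)‖ :=
  (re_csq_shift_ge hp hn).trans (Complex.re_le_norm _)

/-- (plumbing for the cited display) [cite: FederbushWilliamson1987PhaseCellII, (6.6)–(6.7) p. 1418] -/
theorem csq_shift_ne_zero {p : Momentum} (hp : p ∈ U) {n : Idx} (hn : n ≠ 0) : csq (shift p n) ≠ 0 := by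
  intro h; have := norm_csq_shift_ge hp hn; rw [h, norm_zero] at this; linarith

/-! ## Bounds on `ratio` and `termD` -/

/-- (plumbing for the cited display) [cite: FederbushWilliamson1987PhaseCellII, (6.6)–(6.7) p. 1418] -/
theorem ratio_of_eq {n : Idx} {i : Fin 4} (h : n i = 0) (p : Momentum) : ratio n p i = 1 := by simp [ratio, h]

/-- (plumbing for the cited display) [cite: FederbushWilliamson1987PhaseCellII, (6.6)–(6.7) p. 1418] -/
theorem ratio_of_ne {n : Idx} {i : Fin 4} (h : n i ≠ 0) (p : Momentum) :
    ratio n p i = (p i) ^ 2 / (shift p n i) ^ 2 := by simp [ratio, h]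

/-- `‖ratio_i‖ ≤ ‖p_i‖²/(25 n_i²)` for `n_i ≠ 0` on the ball. [cite: FederbushWilliamson1987PhaseCellII, (6.8) p. 1418] -/
theorem norm_ratio_le {p : Momentum} (hp : p ∈ U) {n : Idx} {i : Fin 4} (hni : n i ≠ 0) :
    ‖ratio n p i‖ ≤ ‖p i‖ ^ 2 / (25 * (n i : ℝ) ^ 2) := by
  rw [ratio_of_ne hni, norm_div, norm_pow, norm_pow]
  have h1 := norm_shift_ge hp hni
  have h2 := one_le_abs_cast hni
  have h3 : 25 * (n i : ℝ) ^ 2 ≤ ‖shift p n i‖ ^ 2 := by nlinarith [sq_abs ((n i : ℝ)), abs_nonneg ((n i : ℝ))]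
  exact div_le_div_of_nonneg_left (by positivity) (by positivity) h3

/-- `‖ratio_i‖ ≤ b(n_i)` on the ball (all `i`). [cite: FederbushWilliamson1987PhaseCellII, (6.8) p. 1418] -/
theorem norm_ratio_le_b {p : Momentum} (hp : p ∈ U) (n : Idx) (i : Fin 4) : ‖ratio n p i‖ ≤ b (n i) := by
  by_cases h : n i = 0
  · simp [ratio_of_eq h, b, h]
  · refine (norm_ratio_le hp h).trans ?_
    rw [b_of_ne h]
    have : ‖p i‖ ^ 2 ≤ 1 := by
      have h1 := (norm_apply_lt_of_mem_U hp i).le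
      have h2 := norm_nonneg (p i)
      nlinarith
    exact div_le_div_of_nonneg_right this (by positivity)

/-- (plumbing for the cited display) [cite: FederbushWilliamson1987PhaseCellII, (6.8) p. 1418] -/
theorem norm_ratio_le_one {p : Momentum} (hp : p ∈ U) (n : Idx) (i : Fin 4) : ‖ratio n p i‖ ≤ 1 :=
  (norm_ratio_le_b hp n i).trans (b_le_one _)

/-- (plumbing for the cited display) [cite: FederbushWilliamson1987PhaseCellII, (6.8) p. 1418] -/
theorem norm_prod_ratio_le {p : Momentum} (hp : p ∈ U) (n : Idx) : ‖∏ i, ratio n p i‖ ≤ u n := by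
  rw [norm_prod]
  exact Finset.prod_le_prod (fun i _ => norm_nonneg _) fun i _ => norm_ratio_le_b hp n i

/-- THE DOMINATION `‖termD_j(n,p)‖ ≤ u(n)/24` for `n ≠ 0`, `‖p‖ < 1/2` (the printed *"|K_ρ(p)| < m"*, (6.8)).
[cite: FederbushWilliamson1987PhaseCellII, (6.8) p. 1418] -/
theorem norm_termD_le {p : Momentum} (hp : p ∈ U) (j : Fin 4) {n : Idx} (hn : n ≠ 0) :
    ‖termD j n p‖ ≤ u n / 24 := by
  unfold termD
  rw [norm_div, norm_mul]
  have h1 := norm_prod_ratio_le hp n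
  have h2 := norm_ratio_le_one hp n j
  have h3 := norm_csq_shift_ge hp hn
  have h4 : ‖∏ i, ratio n p i‖ * ‖ratio n p j‖ ≤ u n := by
    calc ‖∏ i, ratio n p i‖ * ‖ratio n p j‖ ≤ u n * 1 :=
          mul_le_mul h1 h2 (norm_nonneg _) (u_nonneg n)
      _ = u n := mul_one _
  rw [div_le_div_iff₀ (by linarith) (by norm_num)]
  nlinarith [u_nonneg n, norm_nonneg (∏ i, ratio n p i), norm_nonneg (ratio n p j)]

/-- (plumbing for the cited display) [cite: FederbushWilliamson1987PhaseCellII, (6.8) p. 1418] -/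
theorem norm_termD_le_u {p : Momentum} (hp : p ∈ U) (j : Fin 4) {n : Idx} (hn : n ≠ 0) :
    ‖termD j n p‖ ≤ u n :=
  (norm_termD_le hp j hn).trans (by have := u_nonneg n; linarith)

/-- (plumbing for the cited display) [cite: FederbushWilliamson1987PhaseCellII, (6.8) p. 1418] -/
theorem summable_norm_termD {p : Momentum} (hp : p ∈ U) (j : Fin 4) :
    Summable fun n : NZ => ‖termD j n.1 p‖ :=
  Summable.of_nonneg_of_le (fun _ => norm_nonneg _) (fun n => norm_termD_le_u hp j n.2) summable_u_NZ

/-- (plumbing for the cited display) [cite: FederbushWilliamson1987PhaseCellII, (6.8) p. 1418] -/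
theorem summable_termD {p : Momentum} (hp : p ∈ U) (j : Fin 4) : Summable fun n : NZ => termD j n.1 p :=
  (summable_norm_termD hp j).of_norm

/-- THE UNIFORM BOUND `‖D_j(p)‖ ≤ 1/12` on `‖p‖ < 1/2`. [cite: FederbushWilliamson1987PhaseCellII, (6.8) p. 1418] -/
theorem norm_D_le {p : Momentum} (hp : p ∈ U) (j : Fin 4) : ‖D j p‖ ≤ 1 / 12 := by
  unfold D
  refine (norm_tsum_le_tsum_norm (summable_norm_termD hp j)).trans ?_
  have h1 : ∑' n : NZ, ‖termD j n.1 p‖ ≤ ∑' n : NZ, u n.1 / 24 :=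
    (summable_norm_termD hp j).tsum_le_tsum (fun n => norm_termD_le hp j n.2)
      (summable_u_NZ.div_const _)
  have h2 : ∑' n : NZ, u n.1 / 24 = (∑' n : NZ, u n.1) / 24 := tsum_div_const
  rw [h2] at h1
  have h3 := tsum_u_NZ_le
  have h4 : (29 / 25 : ℝ) ^ 4 / 24 ≤ 1 / 12 := by norm_num
  linarith [div_le_div_of_nonneg_right h3 (by norm_num : (0:ℝ) ≤ 24)]

/-! ## Analyticity of `D_j` on the ball (the honest form of (6.1)) -/

/-- Quotients of holomorphic functions (domain `ℂ⁴`). [folklore] -/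
private theorem differentiableOn_div {f g : Momentum → ℂ} (hf : DifferentiableOn ℂ f U) (hg : DifferentiableOn ℂ g U)
    (h : ∀ p ∈ U, g p ≠ 0) : DifferentiableOn ℂ (fun p => f p / g p) U := by
  have e : (fun p => f p / g p) = fun p => f p * (g p)⁻¹ := funext fun p => div_eq_mul_inv _ _
  rw [e]; exact hf.mul (hg.inv h)

/-- (plumbing for the cited display) [cite: FederbushWilliamson1987PhaseCellII, (6.1) p. 1418] -/
theorem differentiableOn_shift_apply (n : Idx) (i : Fin 4) : DifferentiableOn ℂ (fun p : Momentum => shift p n i) U :=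
  ((differentiable_apply i).add (differentiable_const _)).differentiableOn

/-- (plumbing for the cited display) [cite: FederbushWilliamson1987PhaseCellII, (6.1) p. 1418] -/
theorem differentiableOn_ratio (n : Idx) (i : Fin 4) : DifferentiableOn ℂ (fun p : Momentum => ratio n p i) U := by
  by_cases h : n i = 0
  · simp only [ratio_of_eq h]; exact differentiableOn_const _
  · simp only [ratio_of_ne h]
    exact differentiableOn_div ((differentiable_apply i).pow 2).differentiableOn
      ((differentiableOn_shift_apply n i).pow 2) fun p hp => pow_ne_zero _ (shift_ne_zero hp h)

/-- (plumbing for the cited display) [cite: FederbushWilliamson1987PhaseCellII, (6.1) p. 1418] -/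
theorem differentiableOn_csq_shift (n : Idx) : DifferentiableOn ℂ (fun p : Momentum => csq (shift p n)) U := by
  unfold csq
  exact DifferentiableOn.fun_sum fun l _ => (differentiableOn_shift_apply n l).pow 2

/-- (plumbing for the cited display) [cite: FederbushWilliamson1987PhaseCellII, (6.1) p. 1418] -/
theorem differentiableOn_prod_ratio (n : Idx) : DifferentiableOn ℂ (fun p : Momentum => ∏ i, ratio n p i) U := by
  simp only [Fin.prod_univ_four]
  exact (((differentiableOn_ratio n 0).mul (differentiableOn_ratio n 1)).mul (differentiableOn_ratio n 2)).mul
    (differentiableOn_ratio n 3)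

/-- Each term is holomorphic on the ball. [cite: FederbushWilliamson1987PhaseCellII, (6.1), (6.6)–(6.7) p. 1418] -/
theorem differentiableOn_termD (j : Fin 4) {n : Idx} (hn : n ≠ 0) : DifferentiableOn ℂ (termD j n) U := by
  unfold termD
  exact differentiableOn_div ((differentiableOn_prod_ratio n).mul (differentiableOn_ratio n j))
    (differentiableOn_csq_shift n) fun p hp => csq_shift_ne_zero hp hn

/-- **`D_j` is analytic on `‖p‖ < 1/2`** (normal convergence + Weierstrass). [cite: FederbushWilliamson1987PhaseCellII,
(6.1), (6.8) p. 1418] -/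
theorem analyticOnNhd_D (j : Fin 4) : AnalyticOnNhd ℂ (D j) U := by
  have h := Literature.Analysis.Complex.SCV.analyticOnNhd_tsum_of_summable_norm (F := ℂ)
    (f := fun (n : NZ) (p : Momentum) => termD j n.1 p) isOpen_U (fun n => differentiableOn_termD j n.2)
    summable_u_NZ (fun n p hp => norm_termD_le_u hp j n.2)
  exact h

/-- (plumbing for the cited display) [cite: FederbushWilliamson1987PhaseCellII, (6.1) p. 1418] -/
theorem differentiableOn_D (j : Fin 4) : DifferentiableOn ℂ (D j) U := (analyticOnNhd_D j).differentiableOn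

/-- (plumbing for the cited display) [cite: FederbushWilliamson1987PhaseCellII, §V p. 1418] -/
theorem zero_mem_U : (0 : Momentum) ∈ U := by simp [U]

end ModeAnalyticityLatticeSums

end Literature.MathematicalPhysics.QuantumFieldTheory.Federbush1986
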